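import Literature.Barriers.RiemannHypothesis.LittlewoodOscillationProofs
import Literature.Barriers.RiemannHypothesis.LittlewoodOscillationRouteClosures
import Literature.NumberTheory.LFunctions.PsiOscillationFromZero
import Literature.NumberTheory.LFunctions.VonKochTheorem
import Literature.NumberTheory.LFunctions.CramerMeanSquareRH
import Literature.NumberTheory.LFunctions.ZeroGaps
import Literature.NumberTheory.DiophantineGeometry.NamedHypothesesRHProofs
import HarnessLib

/-!
# Splittings — zd neg lens: the PRIME-SIDE tails (`ψ`, `θ`) above an abscissa — every refutable one refuted for ALL onsets and
# constants (Littlewood, tree-proved), every irrefutable one-sided power tail split-alone and RH-EQUIVALENT over all `b > 1/2`, FIN-free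
# (SPLIT-zd-neg gen 6 §2; zero-definition raw form)

Cell rh-split, seat rh-split-zd-neg g6 (brief sha16 f79c5f09d8bcb036), card `run/shared/lean/pub/rh-split/cards/SPLIT-zd-neg.md` (gen-6 addendum);
zero-definition raw form of §2 of `HOME/rh-split-zd-neg/SketchG6.lean` (sha16 5d5acaefd4b823a7), filed by rh-split-typer-1 g4 (lead 04:22:05Z
«optional carve SketchG6 §2 … after referee g3's replay»).  The scratch's six tail abbreviations (`PsiUpperTail K X := ∀ x ≥ X, ψ x − x ≤ K√x`,
`PsiLowerTail`, `ThetaUpperTail`, `ThetaLowerTail`, `PsiUpperTailPow K b X := ∀ x ≥ X, ψ x − x ≤ K x^b`, `PsiLowerTailPow`) and `FIN :=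
riemannHypothesisUpTo_platt_trudgian` are SPELLED OUT VERBATIM at every site; proofs verbatim; §0/§1 (frame, spacing-axis window data with
the two named float claims) are NOT carried.
HONEST LABEL: «SPLITTING SEARCH over kernel-typed RH-EQUIVALENCES; a splitting A ∧ B ⟹ RH is CONDITIONAL bookkeeping
unless A and B are both proved; nothing here bears on the truth of RH.»

Content (rows N45–N50 of the card; everything over existing tree declarations):
* every REFUTABLE prime-side tail is refuted for ALL onsets `X` and ALL constants `K` by the tree's PROVED Littlewood theorem
  (`LittlewoodOscillation_holds`): each ONE-SIDED `√x`-tail of `ψ` (`not_psiUpperTail`, `not_psiLowerTail`), the two-sided one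
  (`not_psiTwoSidedTail`), and of `θ` (`not_thetaLowerTail` via `θ ≤ ψ`; `not_thetaUpperTail` via Mathlib `Chebyshev.psi_sub_theta_le_mul_sqrt`;
  in particular `θ(x) < x` fails for arbitrarily large `x`, `not_theta_lt_self_tail`);
* every IRREFUTABLE one-sided power tail is split-alone: a one-sided `x^b`-tail (`b > 0`, either side) excludes the zeros with `Re ρ > b`
  (`re_le_of_psiUpperTailPow`, `re_le_of_psiLowerTailPow`; Landau / Montgomery–Vaughan Thm. 15.3, tree
  `PsiOscillation.frequently_le_psi_sub_and_psi_sub_le`), and the family over all `b > 1/2` is RH-EQUIVALENT with NO `FIN` hypothesis anywhere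
  (`psiUpperTailPow_iff_rh`, `psiLowerTailPow_iff_rh`; RH ⟹ tails by the tree's von Koch theorem, `abs_psi_tailPow_of_rh`) — `FIN` is
  DECORATION on the prime side, exhibited syntactically by `rh_of_fin_of_psiUpperTailPow` (hypothesis unused).  Referee g3 label requested by
  the seat; class (zd, neg) UNCHANGED (lead 04:22:05Z: barrier note).
-/

set_option linter.dupNamespace false

noncomputable section

open Filter Asymptotics
open scoped Topology Chebyshev
open Literature.NumberTheory.DiophantineGeometry Literature.NumberTheory.LFunctions
open Literature.Barriers.RiemannHypothesis

namespace Summit.RiemannHypothesis.RiemannHypothesis.Theorems.Splittings.ZdPrimeSideTails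

/-! ## The prime side: `ψ`- and `θ`-tails above an abscissa `X` -/

/-- Generic: `f = Ω₊(g)` with `g/k → ∞` along positive `k` beats `K·k` for arbitrarily large `x`. -/
theorem frequently_lt_of_isOmegaPlus {f g k : ℝ → ℝ} (h : IsOmegaPlus f g)
    (hk : ∀ᶠ x in atTop, 0 < k x) (hgk : Tendsto (fun x ↦ g x / k x) atTop atTop) (K : ℝ) :
    ∃ᶠ x in atTop, K * k x < f x := by
  obtain ⟨c, hc, hfreq⟩ := h
  have hev : ∀ᶠ x in atTop, K / c < g x / k x := hgk.eventually_gt_atTop (K / c)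
  refine (hfreq.and_eventually (hk.and hev)).mono fun x hx ↦ ?_
  obtain ⟨hle, hkx, hgt⟩ := hx
  rw [div_lt_div_iff₀ hc hkx] at hgt
  nlinarith

/-- Generic: `f = Ω₋(g)` with `g/k → ∞` along positive `k` goes below `−K·k` for arbitrarily large `x`. -/
theorem frequently_lt_neg_of_isOmegaMinus {f g k : ℝ → ℝ} (h : IsOmegaMinus f g)
    (hk : ∀ᶠ x in atTop, 0 < k x) (hgk : Tendsto (fun x ↦ g x / k x) atTop atTop) (K : ℝ) :
    ∃ᶠ x in atTop, f x < -(K * k x) := by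
  rw [isOmegaMinus_iff_isOmegaPlus_neg] at h
  exact (frequently_lt_of_isOmegaPlus h hk hgk K).mono fun x hx ↦ by linarith

/-- `x^{1/2} > 0` eventually. -/
private theorem eventually_sqrt_pos : ∀ᶠ x : ℝ in atTop, 0 < x ^ (1 / 2 : ℝ) := by
  filter_upwards [eventually_gt_atTop 0] with x hx using Real.rpow_pos_of_pos hx _

/-- (N46⁺) `ψ(x) − x ≤ K√x` beyond `X`: DEAD for every `K` and every `X` (Littlewood `Ω₊`, PROVED in
the tree: `LittlewoodOscillation_holds`). -/
theorem not_psiUpperTail (K X : ℝ) : ¬ ∀ x : ℝ, X ≤ x → ψ x - x ≤ K * x ^ (1 / 2 : ℝ) := by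
  intro h
  have hfreq := frequently_lt_of_isOmegaPlus LittlewoodOscillation_holds.1.1 eventually_sqrt_pos
    tendsto_littlewoodGaugePsi_div_sqrt K
  obtain ⟨x, hlt, hX⟩ := (hfreq.and_eventually (eventually_ge_atTop X)).exists
  have := h x hX
  linarith

/-- (N46⁻) `−K√x ≤ ψ(x) − x` beyond `X`: DEAD for every `K` and every `X` (Littlewood `Ω₋`). -/
theorem not_psiLowerTail (K X : ℝ) : ¬ (∀ x : ℝ, X ≤ x → -(K * x ^ (1 / 2 : ℝ)) ≤ ψ x - x) := by
  intro h
  have hfreq := frequently_lt_neg_of_isOmegaMinus LittlewoodOscillation_holds.1.2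
    eventually_sqrt_pos tendsto_littlewoodGaugePsi_div_sqrt K
  obtain ⟨x, hlt, hX⟩ := (hfreq.and_eventually (eventually_ge_atTop X)).exists
  have := h x hX
  linarith

/-- (N45) hence the two-sided tail `|ψ(x) − x| ≤ K√x` beyond `X` is dead for every `K`, `X`. -/
theorem not_psiTwoSidedTail (K X : ℝ) : ¬ ∀ x : ℝ, X ≤ x → |ψ x - x| ≤ K * x ^ (1 / 2 : ℝ) :=
  fun h ↦ not_psiUpperTail K X fun x hx ↦ (le_abs_self _).trans (h x hx)

/-- (N50⁻) `−K√x ≤ θ(x) − x` beyond `X`: DEAD for every `K`, `X` (`θ ≤ ψ` and Littlewood `Ω₋`). -/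
theorem not_thetaLowerTail (K X : ℝ) : ¬ (∀ x : ℝ, X ≤ x → -(K * x ^ (1 / 2 : ℝ)) ≤ θ x - x) := by
  intro h
  refine not_psiLowerTail K X fun x hx ↦ (h x hx).trans ?_
  linarith [Chebyshev.theta_le_psi x]

/-- (N50⁺) `θ(x) − x ≤ K√x` beyond `X`: DEAD for every `K`, `X` — in particular `θ(x) < x` does
not hold for all large `x` (`ψ − θ ≤ C√x`, Mathlib `Chebyshev.psi_sub_theta_le_mul_sqrt`, and
Littlewood `Ω₊` with the extra factor `log log log x`). -/
theorem not_thetaUpperTail (K X : ℝ) : ¬ ∀ x : ℝ, X ≤ x → θ x - x ≤ K * x ^ (1 / 2 : ℝ) := by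
  intro h
  obtain ⟨C, hC⟩ := Chebyshev.psi_sub_theta_le_mul_sqrt
  refine not_psiUpperTail (K + C) X fun x hx ↦ ?_
  have h1 := h x hx
  have h2 := hC x
  rw [Real.sqrt_eq_rpow] at h2
  linarith

/-- `θ(x) < x` for all `x ≥ X` is refuted for every `X` (the one-signed `θ`-comparison). -/
theorem not_theta_lt_self_tail (X : ℝ) : ¬ ∀ x : ℝ, X ≤ x → θ x < x :=
  fun h ↦ not_thetaUpperTail 0 X fun x hx ↦ by have := h x hx; simp; linarith

/-! ### One-sided power tails: split-alone, and RH-equivalent over all `b > 1/2` (FIN-free) -/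

/-- (N47) A one-sided upper tail `ψ(x) − x ≤ K x^b` (`b > 0`) beyond any `X` excludes every zero
with `Re ρ > b` (Landau's method, MV Thm. 15.3; tree
`PsiOscillation.frequently_le_psi_sub_and_psi_sub_le`). No `FIN`, no height. -/
theorem re_le_of_psiUpperTailPow {K b X : ℝ} (hb : 0 < b) (h : ∀ x : ℝ, X ≤ x → ψ x - x ≤ K * x ^ b)
    (s : ℂ) (hs : riemannZeta s = 0) : s.re ≤ b := by
  by_contra hlt
  replace hlt : b < s.re := lt_of_not_ge hlt
  have hre : 0 < s.re := hb.trans hlt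
  have hnorm : 0 < ‖s‖ := by
    have : s ≠ 0 := fun h0 ↦ by simp [h0] at hre
    exact norm_pos_iff.mpr this
  -- a constant `c` with `0 < c < 1/‖s‖`
  obtain ⟨c, hc0, hc1⟩ : ∃ c : ℝ, 0 < c ∧ c < 1 / ‖s‖ :=
    ⟨1 / ‖s‖ / 2, by positivity, by linarith [show 0 < 1 / ‖s‖ from by positivity]⟩
  have hfreq := (PsiOscillation.frequently_le_psi_sub_and_psi_sub_le hs hre hc0 hc1).1
  -- eventually `K x^b < c x^{Re s}`
  have hev : ∀ᶠ x : ℝ in atTop, K * x ^ b < c * x ^ s.re := by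
    have hgap : 0 < s.re - b := sub_pos.mpr hlt
    have ht : Tendsto (fun x : ℝ ↦ x ^ (s.re - b)) atTop atTop := tendsto_rpow_atTop hgap
    filter_upwards [ht.eventually_gt_atTop (K / c), eventually_gt_atTop 0] with x hx hx0
    have hxb : 0 < x ^ b := Real.rpow_pos_of_pos hx0 _
    have hsplit : x ^ s.re = x ^ b * x ^ (s.re - b) := by
      rw [← Real.rpow_add hx0]; ring_nf
    rw [hsplit, div_lt_iff₀ hc0] at *
    nlinarith [mul_lt_mul_of_pos_left hx hxb]
  obtain ⟨x, hle, hK, hX⟩ := (hfreq.and_eventually (hev.and (eventually_ge_atTop X))).exists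
  have := h x hX
  linarith

/-- Symmetric (N47⁻): a one-sided LOWER tail `−K x^b ≤ ψ(x) − x` also excludes `Re ρ > b`. -/
theorem re_le_of_psiLowerTailPow {K b X : ℝ} (hb : 0 < b) (h : ∀ x : ℝ, X ≤ x → -(K * x ^ b) ≤ ψ x - x)
    (s : ℂ) (hs : riemannZeta s = 0) : s.re ≤ b := by
  by_contra hlt
  replace hlt : b < s.re := lt_of_not_ge hlt
  have hre : 0 < s.re := hb.trans hlt
  have hnorm : 0 < ‖s‖ := by
    have : s ≠ 0 := fun h0 ↦ by simp [h0] at hre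
    exact norm_pos_iff.mpr this
  obtain ⟨c, hc0, hc1⟩ : ∃ c : ℝ, 0 < c ∧ c < 1 / ‖s‖ :=
    ⟨1 / ‖s‖ / 2, by positivity, by linarith [show 0 < 1 / ‖s‖ from by positivity]⟩
  have hfreq := (PsiOscillation.frequently_le_psi_sub_and_psi_sub_le hs hre hc0 hc1).2
  have hev : ∀ᶠ x : ℝ in atTop, K * x ^ b < c * x ^ s.re := by
    have hgap : 0 < s.re - b := sub_pos.mpr hlt
    have ht : Tendsto (fun x : ℝ ↦ x ^ (s.re - b)) atTop atTop := tendsto_rpow_atTop hgap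
    filter_upwards [ht.eventually_gt_atTop (K / c), eventually_gt_atTop 0] with x hx hx0
    have hxb : 0 < x ^ b := Real.rpow_pos_of_pos hx0 _
    have hsplit : x ^ s.re = x ^ b * x ^ (s.re - b) := by
      rw [← Real.rpow_add hx0]; ring_nf
    rw [hsplit, div_lt_iff₀ hc0] at *
    nlinarith [mul_lt_mul_of_pos_left hx hxb]
  obtain ⟨x, hle, hK, hX⟩ := (hfreq.and_eventually (hev.and (eventually_ge_atTop X))).exists
  have := h x hX
  linarith

/-- (N47, assembly) the one-sided upper tails over ALL `b > 1/2` give RH — with NO finite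
verification anywhere: `FIN` is decoration on the prime side. -/
theorem rh_of_psiUpperTailPow (h : ∀ b : ℝ, 1 / 2 < b → ∃ K X : ℝ, ∀ x : ℝ, X ≤ x → ψ x - x ≤ K * x ^ b) :
    RiemannHypothesis := by
  by_contra hRH
  obtain ⟨ρ, hζ, -, hρ⟩ := exists_zero_half_lt_re_of_not_riemannHypothesis hRH
  obtain ⟨K, X, hKX⟩ := h ((1 / 2 + ρ.re) / 2) (by linarith)
  have := re_le_of_psiUpperTailPow (by linarith) hKX ρ hζ
  linarith

/-- Symmetric assembly: the one-sided LOWER tails over all `b > 1/2` give RH (FIN-free). -/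
theorem rh_of_psiLowerTailPow (h : ∀ b : ℝ, 1 / 2 < b → ∃ K X : ℝ, ∀ x : ℝ, X ≤ x → -(K * x ^ b) ≤ ψ x - x) :
    RiemannHypothesis := by
  by_contra hRH
  obtain ⟨ρ, hζ, -, hρ⟩ := exists_zero_half_lt_re_of_not_riemannHypothesis hRH
  obtain ⟨K, X, hKX⟩ := h ((1 / 2 + ρ.re) / 2) (by linarith)
  have := re_le_of_psiLowerTailPow (by linarith) hKX ρ hζ
  linarith

/-- Under RH, `|ψ(x) − x| ≤ K x^b` beyond some `X`, for every `b > 1/2` (von Koch, PROVED in the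
tree: `vonKoch_chebyshevPsi_of_riemannHypothesis_holds`, and `log² x = o(x^{b − 1/2})`). -/
theorem abs_psi_tailPow_of_rh (hRH : RiemannHypothesis) {b : ℝ} (hb : 1 / 2 < b) :
    ∃ K X : ℝ, ∀ x : ℝ, X ≤ x → |ψ x - x| ≤ K * x ^ b := by
  have hO : (fun x ↦ ψ x - x) =O[atTop] fun x ↦ x ^ (1 / 2 : ℝ) * Real.log x ^ 2 :=
    vonKoch_chebyshevPsi_of_riemannHypothesis_holds hRH
  have ho : (fun x : ℝ ↦ x ^ (1 / 2 : ℝ) * Real.log x ^ 2) =o[atTop] fun x ↦ x ^ b := by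
    have h1 : (fun x : ℝ ↦ Real.log x ^ (2 : ℝ)) =o[atTop] fun x ↦ x ^ (b - 1 / 2) :=
      isLittleO_log_rpow_rpow_atTop 2 (by linarith)
    have h2 : (fun x : ℝ ↦ x ^ (1 / 2 : ℝ) * Real.log x ^ (2 : ℝ)) =o[atTop]
        fun x ↦ x ^ (1 / 2 : ℝ) * x ^ (b - 1 / 2) :=
      (isBigO_refl _ _).mul_isLittleO h1
    refine (h2.congr' ?_ ?_)
    · filter_upwards [eventually_gt_atTop 0] with x hx
      rw [← Real.rpow_natCast]; norm_num
    · filter_upwards [eventually_gt_atTop 0] with x hx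
      rw [← Real.rpow_add hx]; ring_nf
  obtain ⟨K, hK⟩ := (hO.trans_isLittleO ho).isBigO.bound
  rw [Filter.eventually_atTop] at hK
  obtain ⟨X, hX⟩ := hK
  refine ⟨K, max X 1, fun x hx ↦ ?_⟩
  have hx1 : 1 ≤ x := le_trans (le_max_right _ _) hx
  have h := hX x (le_trans (le_max_left _ _) hx)
  have hxb : 0 < x ^ b := Real.rpow_pos_of_pos (by linarith) _
  rw [Real.norm_eq_abs, Real.norm_eq_abs, abs_of_pos hxb] at h
  exact h

/-- RH ⟹ the one-sided upper power tail for every `b > 1/2` (from `abs_psi_tailPow_of_rh`). -/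
theorem psiUpperTailPow_of_rh (hRH : RiemannHypothesis) {b : ℝ} (hb : 1 / 2 < b) :
    ∃ K X : ℝ, ∀ x : ℝ, X ≤ x → ψ x - x ≤ K * x ^ b := by
  obtain ⟨K, X, h⟩ := abs_psi_tailPow_of_rh hRH hb
  exact ⟨K, X, fun x hx ↦ (le_abs_self _).trans (h x hx)⟩

/-- RH ⟹ the one-sided lower power tail for every `b > 1/2` (from `abs_psi_tailPow_of_rh`). -/
theorem psiLowerTailPow_of_rh (hRH : RiemannHypothesis) {b : ℝ} (hb : 1 / 2 < b) :
    ∃ K X : ℝ, ∀ x : ℝ, X ≤ x → -(K * x ^ b) ≤ ψ x - x := by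
  obtain ⟨K, X, h⟩ := abs_psi_tailPow_of_rh hRH hb
  exact ⟨K, X, fun x hx ↦ neg_le_of_abs_le (h x hx)⟩

/-- (N47, verdict) RELABELLING, FIN-free: the family of one-sided upper power tails over all
`b > 1/2` is RH-EQUIVALENT with no finite verification in sight. -/
theorem psiUpperTailPow_iff_rh :
    (∀ b : ℝ, 1 / 2 < b → ∃ K X : ℝ, ∀ x : ℝ, X ≤ x → ψ x - x ≤ K * x ^ b) ↔ RiemannHypothesis :=
  ⟨rh_of_psiUpperTailPow, fun hRH _ hb ↦ psiUpperTailPow_of_rh hRH hb⟩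

/-- (N47⁻, verdict) the lower family over all `b > 1/2` is likewise RH-EQUIVALENT, FIN-free. -/
theorem psiLowerTailPow_iff_rh :
    (∀ b : ℝ, 1 / 2 < b → ∃ K X : ℝ, ∀ x : ℝ, X ≤ x → -(K * x ^ b) ≤ ψ x - x) ↔ RiemannHypothesis :=
  ⟨rh_of_psiLowerTailPow, fun hRH _ hb ↦ psiLowerTailPow_of_rh hRH hb⟩

/-- (N47, FIN decoration exhibited) the «splitting» `FIN ∧ (one-sided tails) → RH` holds with the
`FIN` hypothesis unused. -/
theorem rh_of_fin_of_psiUpperTailPow (_hA : riemannHypothesisUpTo_platt_trudgian)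
    (h : ∀ b : ℝ, 1 / 2 < b → ∃ K X : ℝ, ∀ x : ℝ, X ≤ x → ψ x - x ≤ K * x ^ b) : RiemannHypothesis :=
  rh_of_psiUpperTailPow h

end Summit.RiemannHypothesis.RiemannHypothesis.Theorems.Splittings.ZdPrimeSideTails

end
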